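import Literature.Analysis.FunctionSpaces.TorusClassicalNSLinearisationH1
import Literature.Analysis.FunctionSpaces.TorusLinearisedNSBaseDependence
import HarnessLib

/-!
# The second-order Taylor remainder of the Navier–Stokes solution map on `T³`
# (twice Fréchet differentiability from `V` into `H`, with a locally uniform cubic remainder)

Function-space support file (all results proved; no definitions, no named facts), sequel of
`TorusClassicalNSLinearisation` / `…H1` (first-order remainder `r = u₂ − u₁ − w`,
`‖r(t)‖²_{H¹} ≤ K‖δ(a)‖⁴_{H¹}`) and `TorusLinearisedNSBaseDependence` (pairings absorbed by the
dissipation, `L⁴` bound of the linearised flow). Setting: two classical solutions `(u₁, p₁)`,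
`(u₂, p₂)` on `[a, a + τ] × T^d`, `card d = 3`, same viscosity `ν > 0` and force, zero-mean slices,
`‖u₁‖, ‖u₂‖ ≤ M`, `‖∂ᵢu₁‖ ≤ Cᵢ`, `∑ᵢCᵢ ≤ Λ`; `δ = u₂ − u₁`; the FIRST VARIATION `(w, q)`: a
zero-mean linearised solution along `u₁` with `w(a) = δ(a)`; the (halved) SECOND VARIATION
`(ζ, π)`: a smooth solution of the linearised equation along `u₁` with the source `−(w·∇)w` and
`ζ(a) = 0` (so `ζ = ½ D²S(t)(u₁(a))[δ(a), δ(a)]`, the quadratic term `(u·∇)u` differentiated twice;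
Temam 1997, Ch. VI §8). Then the second-order Taylor remainder `ρ = u₂ − u₁ − w − ζ` satisfies

`∫ ‖ρ(t)‖² ≤ K (∫‖δ(a)‖² + ‖∇δ(a)‖₂²)³` on `[a, a + τ]`, `K = K(ν, M, Λ, τ)`

(`Torus.IsClassicalNSSolutionOn.exists_integral_norm_secondRemainder_sq_le`), i.e.
`‖S(t)(u₁(a) + h) − S(t)u₁(a) − DS·h − ½D²S(h, h)‖_{L²} ≤ √K ‖h‖³_{H¹}` uniformly over base points
and increments obeying the coefficient bounds.

Proof: `ρ = r − ζ` solves the linearised equation along `u₁` with source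
`−(δ·∇)δ + (w·∇)w = −(δ·∇)r − (r·∇)w` (`Torus.convect_self_sub_convect_self`); both pairings are
absorbed by the dissipation (`Torus.two_mul_abs_integral_inner_convect_le_of_isDivFree`) up to
`ν⁻¹(‖δ‖²_{L⁴}‖r‖²_{L⁴} + ‖r‖²_{L⁴}‖w‖²_{L⁴}) ≤ c H₀³`, by Ladyzhenskaya for the zero-mean `r`
with `‖∇r‖₂² ≤ K_V H₀²` (`….exists_gradNormSq_sub_sub_le`), `∫‖δ‖⁴ ≤ K₄H₀²`
(`….exists_integral_norm_sub_pow_four_le`) and `∫‖w‖⁴ ≤ K_w H₀²`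
(`Torus.exists_linearisedNS_integral_norm_pow_four_le`); Grönwall
(`Torus.linearisedNSForced_integral_norm_sq_le`) with `ρ(a) = 0`.

## Mathlib / tree search

Tree (`lean search 'secondRemainder|second variation|D²S'`): none; reused: the files above and
`Torus.linearisedNSForced_sub_eq`, `Torus.IsClassicalNSSolutionOn.linearisedNSForced_sub`,
`Torus.integral_norm_pow_four_le_gradNormSq_sq`, `Torus.fderiv_sub`. Mathlib: `map_sub`,
`Real.sqrt_le_sqrt`, `Real.sqrt_mul`, `Real.sqrt_sq`.

## References

* R. Temam, *Infinite-Dimensional Dynamical Systems in Mechanics and Physics*, 2nd ed., Springer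
  1997, Ch. VI §3.1 (3.12) and §8 (differentiability of the semigroup). [`Temam1997`]
* P. Constantin, C. Foias, *Navier–Stokes Equations*, Univ. Chicago Press 1988, Ch. 14,
  Lemma 14.3 (14.10). [`ConstantinFoiasNSE1988`]
-/

open MeasureTheory Set Filter
open scoped InnerProductSpace ContDiff Topology

noncomputable section

namespace Literature.Analysis.FunctionSpaces

namespace Torus

variable {d : Type*} [Fintype d] [DecidableEq d]

omit [DecidableEq d] in
/-- **The quadratic defect of the convection term**: for `C¹` fields `δ, w` on `T^d` and
`r = δ − w`, `(δ·∇)δ − (w·∇)w = (δ·∇)r + (r·∇)w` pointwise (bilinearity). [folklore] -/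
theorem convect_self_sub_convect_self {δ w : UnitAddTorus d → EuclideanSpace ℝ d}
    (hδ : IsContDiff 1 δ) (hw : IsContDiff 1 w) (x : UnitAddTorus d) :
    convect δ δ x - convect w w x =
      convect δ (fun y => δ y - w y) x + convect (fun y => δ y - w y) w x := by
  have h12 : (fun y => δ y - w y) = δ - w := rfl
  simp only [convect, h12, fderiv_sub hδ hw, sub_apply, map_sub]
  abel

section Three

variable {ν M Λ τ : ℝ}

/-- **The second-order Taylor remainder estimate for the Navier–Stokes solution map on `T³`.**
On `T^d` with `card d = 3`, for `ν > 0`, `Λ ≥ 0`, `τ > 0` and `M` there is `K ≥ 0` (depending only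
on these) such that: for two classical solutions `(u₁, p₁)`, `(u₂, p₂)` on `[a, a + τ] × T^d` (same
viscosity `ν` and force) with zero-mean slices, `‖u₁‖, ‖u₂‖ ≤ M`, `‖∂ᵢu₁‖ ≤ Cᵢ`, `∑ᵢCᵢ ≤ Λ`, every
zero-mean smooth solution `(w, q)` of the linearised equation along `u₁` with `w(a) = (u₂ − u₁)(a)`
and every smooth solution `(ζ, π)` of the linearised equation along `u₁` with source `−(w·∇)w`
and `ζ(a) = 0`, the second-order remainder obeys, for all `t ∈ [a, a + τ]`,
`∫ ‖(u₂ − u₁ − w − ζ)(t)‖² ≤ K (∫‖(u₂ − u₁)(a)‖² + ‖∇(u₂ − u₁)(a)‖₂²)³`.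
[cite: Temam1997, Ch. VI §3.1 (3.12)] -/
theorem IsClassicalNSSolutionOn.exists_integral_norm_secondRemainder_sq_le
    (hd : Fintype.card d = 3) (hν : 0 < ν) (hΛ : 0 ≤ Λ) (hτ : 0 < τ) (M : ℝ) :
    ∃ K : ℝ, 0 ≤ K ∧ ∀ {a : ℝ} {f u₁ u₂ w ζ : ℝ → UnitAddTorus d → EuclideanSpace ℝ d}
      {p₁ p₂ q π : ℝ → UnitAddTorus d → ℝ} {C : d → ℝ},
      IsClassicalNSSolutionOn (Icc a (a + τ)) ν f u₁ p₁ →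
      IsClassicalNSSolutionOn (Icc a (a + τ)) ν f u₂ p₂ →
      (∀ t ∈ Icc a (a + τ), HasZeroMean (u₁ t)) → (∀ t ∈ Icc a (a + τ), HasZeroMean (u₂ t)) →
      (∀ t ∈ Icc a (a + τ), ∀ x, ‖u₁ t x‖ ≤ M) → (∀ t ∈ Icc a (a + τ), ∀ x, ‖u₂ t x‖ ≤ M) →
      (∀ i, ∀ t ∈ Icc a (a + τ), ∀ x, ‖partialDeriv i (u₁ t) x‖ ≤ C i) → ∑ i, C i ≤ Λ →
      IsSmoothSpaceTimeOn (Icc a (a + τ)) w → IsSmoothSpaceTimeOn (Icc a (a + τ)) q →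
      (∀ t ∈ Icc a (a + τ), IsDivFree (w t)) → (∀ t ∈ Icc a (a + τ), HasZeroMean (w t)) →
      (∀ t ∈ Icc a (a + τ), ∀ x, timeDerivWithin (Icc a (a + τ)) w t x + convect (u₁ t) (w t) x +
        convect (w t) (u₁ t) x = ν • laplacian (w t) x - gradient (q t) x) →
      (∀ y, w a y = u₂ a y - u₁ a y) →
      IsSmoothSpaceTimeOn (Icc a (a + τ)) ζ → IsSmoothSpaceTimeOn (Icc a (a + τ)) π →
      (∀ t ∈ Icc a (a + τ), IsDivFree (ζ t)) →
      (∀ t ∈ Icc a (a + τ), ∀ x, timeDerivWithin (Icc a (a + τ)) ζ t x + convect (u₁ t) (ζ t) x +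
        convect (ζ t) (u₁ t) x = ν • laplacian (ζ t) x - gradient (π t) x +
          -convect (w t) (w t) x) →
      (∀ y, ζ a y = 0) →
      ∀ t ∈ Icc a (a + τ), ∫ x, ‖u₂ t x - u₁ t x - w t x - ζ t x‖ ^ 2 ≤
        K * ((∫ x, ‖u₂ a x - u₁ a x‖ ^ 2) + gradNormSq (fun y => u₂ a y - u₁ a y)) ^ 3 := by
  obtain ⟨K₄, hK₄0, hK₄⟩ :=
    IsClassicalNSSolutionOn.exists_integral_norm_sub_pow_four_le (d := d) hd hν hΛ hτ M
  obtain ⟨KV, hKV0, hKV⟩ := IsClassicalNSSolutionOn.exists_gradNormSq_sub_sub_le (d := d) hd hν hΛ hτ M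
  obtain ⟨Kw, hKw0, hKw⟩ := exists_linearisedNS_integral_norm_pow_four_le (d := d) hd hν hΛ hτ M
  obtain ⟨KL, hKL0, hKL⟩ := integral_norm_pow_four_le_gradNormSq_sq (d := d) hd
  set c : ℝ := ν⁻¹ * (Real.sqrt KL * KV) * (Real.sqrt K₄ + Real.sqrt Kw) with hc
  have hc0 : 0 ≤ c := by positivity
  refine ⟨c * τ * Real.exp (2 * Λ * τ), by positivity, ?_⟩
  intro a f u₁ u₂ w ζ p₁ p₂ q π C h₁ h₂ hz₁ hz₂ hM₁ hM₂ hC hCΛ hw hq hwdiv hwz hlin h0 hζ hπ hζdiv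
    hlinζ hζ0 t ht
  set b : ℝ := a + τ with hb
  have hab : a < b := by rw [hb]; linarith
  have ha : a ∈ Icc a b := left_mem_Icc.2 hab.le
  set H₀ : ℝ := (∫ x, ‖u₂ a x - u₁ a x‖ ^ 2) + gradNormSq (fun y => u₂ a y - u₁ a y) with hH₀
  have hH₀0 : 0 ≤ H₀ := add_nonneg (integral_nonneg fun x => sq_nonneg _) (gradNormSq_nonneg _)
  -- the fields
  set δ : ℝ → UnitAddTorus d → EuclideanSpace ℝ d := fun s y => u₂ s y - u₁ s y with hδ_def
  set r : ℝ → UnitAddTorus d → EuclideanSpace ℝ d := fun s y => δ s y - w s y with hr_def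
  set ρ : ℝ → UnitAddTorus d → EuclideanSpace ℝ d := fun s y => r s y - ζ s y with hρ_def
  set G : ℝ → UnitAddTorus d → EuclideanSpace ℝ d := fun s y => -convect (δ s) (δ s) y with hG_def
  set Z : ℝ → UnitAddTorus d → EuclideanSpace ℝ d := fun _ _ => 0 with hZ_def
  set Gζ : ℝ → UnitAddTorus d → EuclideanSpace ℝ d := fun s y => -convect (w s) (w s) y with hGζ_def
  have hδ : IsSmoothSpaceTimeOn (Icc a b) δ := h₂.smooth_velocity.sub h₁.smooth_velocity
  have hr : IsSmoothSpaceTimeOn (Icc a b) r := hδ.sub hw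
  have hρ : IsSmoothSpaceTimeOn (Icc a b) ρ := hr.sub hζ
  have hp21 : IsSmoothSpaceTimeOn (Icc a b) (fun s y => p₂ s y - p₁ s y) :=
    h₂.smooth_pressure.sub h₁.smooth_pressure
  have hdivsub : ∀ {v₁ v₂ : UnitAddTorus d → EuclideanSpace ℝ d}, IsSmooth v₁ → IsSmooth v₂ →
      IsDivFree v₁ → IsDivFree v₂ → IsDivFree (fun y => v₁ y - v₂ y) := by
    intro v₁ v₂ hv₁ hv₂ hd₁ hd₂ x
    have h12 : (fun y => v₁ y - v₂ y) = v₁ - v₂ := rfl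
    rw [h12, divergence_sub (hv₁.isContDiff (by simp)) (hv₂.isContDiff (by simp)), hd₁ x, hd₂ x,
      sub_zero]
  have hδdiv : ∀ s ∈ Icc a b, IsDivFree (δ s) := fun s hs =>
    hdivsub (h₂.smooth_velocity.isSmooth_slice hs) (h₁.smooth_velocity.isSmooth_slice hs)
      (h₂.divFree s hs) (h₁.divFree s hs)
  have hrdiv : ∀ s ∈ Icc a b, IsDivFree (r s) := fun s hs =>
    hdivsub (hδ.isSmooth_slice hs) (hw.isSmooth_slice hs) (hδdiv s hs) (hwdiv s hs)
  have hρdiv : ∀ s ∈ Icc a b, IsDivFree (ρ s) := fun s hs =>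
    hdivsub (hr.isSmooth_slice hs) (hζ.isSmooth_slice hs) (hrdiv s hs) (hζdiv s hs)
  have hrz : ∀ s ∈ Icc a b, HasZeroMean (r s) := by
    intro s hs
    unfold HasZeroMean
    have i₁ := (h₁.smooth_velocity.isSmooth_slice hs).integrable
    have i₂ := (h₂.smooth_velocity.isSmooth_slice hs).integrable
    have iw := (hw.isSmooth_slice hs).integrable
    have i₂₁ : Integrable (fun x => u₂ s x - u₁ s x) volume := i₂.sub i₁
    have hz₂₁ : ∫ x, (u₂ s x - u₁ s x) = 0 := by
      rw [integral_sub i₂ i₁, hz₂ s hs, hz₁ s hs, sub_zero]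
    show ∫ x, (u₂ s x - u₁ s x - w s x) = 0
    rw [integral_sub i₂₁ iw, hz₂₁, hwz s hs, sub_zero]
  -- the equations: `δ` with source `G`, `w` with `Z`, `r` with `G - Z`, `ρ` with `(G - Z) - Gζ`
  have hlinδ : ∀ s ∈ Icc a b, ∀ x, timeDerivWithin (Icc a b) δ s x + convect (u₁ s) (δ s) x +
      convect (δ s) (u₁ s) x = ν • laplacian (δ s) x - gradient (fun y => p₂ s y - p₁ s y) x +
        G s x := fun s hs x => h₁.linearisedNSForced_sub h₂ hab hs x
  have hlinw : ∀ s ∈ Icc a b, ∀ x, timeDerivWithin (Icc a b) w s x + convect (u₁ s) (w s) x +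
      convect (w s) (u₁ s) x = ν • laplacian (w s) x - gradient (q s) x + Z s x := by
    intro s hs x
    rw [hlin s hs x, hZ_def, add_zero]
  have hlinr : ∀ s ∈ Icc a b, ∀ x, timeDerivWithin (Icc a b) r s x + convect (u₁ s) (r s) x +
      convect (r s) (u₁ s) x = ν • laplacian (r s) x -
        gradient (fun y => (p₂ s y - p₁ s y) - q s y) x + (G s x - Z s x) :=
    fun s hs x => linearisedNSForced_sub_eq hδ hp21 hlinδ hw hq hlinw hab hs x
  have hlinρ : ∀ s ∈ Icc a b, ∀ x, timeDerivWithin (Icc a b) ρ s x + convect (u₁ s) (ρ s) x +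
      convect (ρ s) (u₁ s) x = ν • laplacian (ρ s) x -
        gradient (fun y => ((p₂ s y - p₁ s y) - q s y) - π s y) x + ((G s x - Z s x) - Gζ s x) :=
    fun s hs x => linearisedNSForced_sub_eq hr (hp21.sub hq) hlinr hζ hπ hlinζ hab hs x
  -- the source of `ρ` is `-(δ·∇)r - (r·∇)w`
  have hsrc_eq : ∀ s ∈ Icc a b, ∀ x, (G s x - Z s x) - Gζ s x =
      -(convect (δ s) (r s) x + convect (r s) (w s) x) := by
    intro s hs x
    have h := convect_self_sub_convect_self ((hδ.isSmooth_slice hs).isContDiff (by simp))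
      ((hw.isSmooth_slice hs).isContDiff (by simp)) x
    simp only [hG_def, hZ_def, hGζ_def, sub_zero]
    rw [← h]
    abel
  have hGs : ∀ s ∈ Icc a b, IsSmooth (fun x => (G s x - Z s x) - Gζ s x) := by
    intro s hs
    have hδs := hδ.isSmooth_slice hs
    have hrs := hr.isSmooth_slice hs
    have hws := hw.isSmooth_slice hs
    have h : (fun x => (G s x - Z s x) - Gζ s x) =
        -(fun x => convect (δ s) (r s) x + convect (r s) (w s) x) := by
      funext x; rw [hsrc_eq s hs x, Pi.neg_apply]
    rw [h]
    exact ((hδs.convect hrs).add (hrs.convect hws)).neg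
  -- sizes: `∫‖δ‖⁴ ≤ K₄H₀²`, `‖∇r‖₂² ≤ K_V H₀²`, `∫‖r‖⁴ ≤ K_L K_V² H₀⁴`, `∫‖w‖⁴ ≤ K_w H₀²`
  have hQδ : ∀ s ∈ Icc a b, ∫ x, ‖δ s x‖ ^ 4 ≤ K₄ * H₀ ^ 2 := fun s hs =>
    hK₄ h₁ h₂ hz₁ hz₂ hM₂ hC hCΛ s hs
  have hVr : ∀ s ∈ Icc a b, gradNormSq (r s) ≤ KV * H₀ ^ 2 := fun s hs =>
    hKV h₁ h₂ hz₁ hz₂ hM₁ hM₂ hC hCΛ hw hq hwdiv hlin h0 s hs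
  have hΞ : (∫ x, ‖w a x‖ ^ 2) + gradNormSq (w a) = H₀ := by
    have hwa : w a = fun y => u₂ a y - u₁ a y := funext h0
    rw [hwa]
  have hQw : ∀ s ∈ Icc a b, ∫ x, ‖w s x‖ ^ 4 ≤ Kw * H₀ ^ 2 := by
    intro s hs
    have h := hKw h₁.smooth_velocity h₁.divFree hw hq hwdiv hwz hlin hM₁ hC hCΛ s hs
    rwa [hΞ] at h
  have hQr : ∀ s ∈ Icc a b, ∫ x, ‖r s x‖ ^ 4 ≤ KL * (KV * H₀ ^ 2) ^ 2 := by
    intro s hs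
    have h := hKL _ (hr.isSmooth_slice hs) (hrz s hs)
    have hV0 : 0 ≤ gradNormSq (r s) := gradNormSq_nonneg _
    exact h.trans (by gcongr; exact hVr s hs)
  -- the source pairing is absorbed: constant `G₀ = 2c H₀³`
  set G₀ : ℝ := ν⁻¹ * ((Real.sqrt K₄ * H₀) * (Real.sqrt KL * (KV * H₀ ^ 2))) +
    ν⁻¹ * ((Real.sqrt KL * (KV * H₀ ^ 2)) * (Real.sqrt Kw * H₀)) with hG₀
  have hG₀0 : 0 ≤ G₀ := by positivity
  have hsrc : ∀ s ∈ Icc a b, 2 * ∫ x, ⟪(G s x - Z s x) - Gζ s x, ρ s x⟫_ℝ ≤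
      2 * ν * gradNormSq (ρ s) + 0 * (∫ x, ‖ρ s x‖ ^ 2) + G₀ := by
    intro s hs
    have hδs : IsSmooth (δ s) := hδ.isSmooth_slice hs
    have hrs : IsSmooth (r s) := hr.isSmooth_slice hs
    have hws : IsSmooth (w s) := hw.isSmooth_slice hs
    have hρs : IsSmooth (ρ s) := hρ.isSmooth_slice hs
    have hA := two_mul_abs_integral_inner_convect_le_of_isDivFree hν hδs (hδdiv s hs) hrs hρs
    have hB := two_mul_abs_integral_inner_convect_le_of_isDivFree hν hrs (hrdiv s hs) hws hρs
    have hP1 := integral_norm_sq_mul_norm_sq_le hδs hrs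
    have hP2 := integral_norm_sq_mul_norm_sq_le hrs hws
    have hsδ : Real.sqrt (∫ x, ‖δ s x‖ ^ 4) ≤ Real.sqrt K₄ * H₀ := by
      calc Real.sqrt (∫ x, ‖δ s x‖ ^ 4) ≤ Real.sqrt (K₄ * H₀ ^ 2) := Real.sqrt_le_sqrt (hQδ s hs)
        _ = Real.sqrt K₄ * H₀ := by rw [Real.sqrt_mul hK₄0, Real.sqrt_sq hH₀0]
    have hsr : Real.sqrt (∫ x, ‖r s x‖ ^ 4) ≤ Real.sqrt KL * (KV * H₀ ^ 2) := by
      calc Real.sqrt (∫ x, ‖r s x‖ ^ 4) ≤ Real.sqrt (KL * (KV * H₀ ^ 2) ^ 2) :=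
            Real.sqrt_le_sqrt (hQr s hs)
        _ = Real.sqrt KL * (KV * H₀ ^ 2) := by rw [Real.sqrt_mul hKL0, Real.sqrt_sq (by positivity)]
    have hsw : Real.sqrt (∫ x, ‖w s x‖ ^ 4) ≤ Real.sqrt Kw * H₀ := by
      calc Real.sqrt (∫ x, ‖w s x‖ ^ 4) ≤ Real.sqrt (Kw * H₀ ^ 2) := Real.sqrt_le_sqrt (hQw s hs)
        _ = Real.sqrt Kw * H₀ := by rw [Real.sqrt_mul hKw0, Real.sqrt_sq hH₀0]
    have hP1' : ∫ x, ‖δ s x‖ ^ 2 * ‖r s x‖ ^ 2 ≤ (Real.sqrt K₄ * H₀) * (Real.sqrt KL * (KV * H₀ ^ 2)) :=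
      hP1.trans (mul_le_mul hsδ hsr (Real.sqrt_nonneg _) (by positivity))
    have hP2' : ∫ x, ‖r s x‖ ^ 2 * ‖w s x‖ ^ 2 ≤ (Real.sqrt KL * (KV * H₀ ^ 2)) * (Real.sqrt Kw * H₀) :=
      hP2.trans (mul_le_mul hsr hsw (Real.sqrt_nonneg _) (by positivity))
    have hint : ∫ x, ⟪(G s x - Z s x) - Gζ s x, ρ s x⟫_ℝ = -((∫ x, ⟪convect (δ s) (r s) x, ρ s x⟫_ℝ) +
        ∫ x, ⟪convect (r s) (w s) x, ρ s x⟫_ℝ) := by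
      rw [← integral_add (((hδs.convect hrs).inner hρs).integrable)
        (((hrs.convect hws).inner hρs).integrable), ← integral_neg]
      refine integral_congr_ae (ae_of_all _ fun x => ?_)
      simp only [hsrc_eq s hs x, inner_neg_left, inner_add_left]
    rw [hint, zero_mul, add_zero]
    have hν0 : 0 ≤ ν⁻¹ := (inv_pos.2 hν).le
    have hm1 := mul_le_mul_of_nonneg_left hP1' hν0
    have hm2 := mul_le_mul_of_nonneg_left hP2' hν0
    have hab1 := neg_abs_le (∫ x, ⟪convect (δ s) (r s) x, ρ s x⟫_ℝ)
    have hab2 := neg_abs_le (∫ x, ⟪convect (r s) (w s) x, ρ s x⟫_ℝ)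
    simp only [hG₀]
    linarith
  -- Grönwall with `ρ(a) = 0`
  have hgr := linearisedNSForced_integral_norm_sq_le h₁.smooth_velocity h₁.divFree hρ
    ((hp21.sub hq).sub hπ) hρdiv hGs hlinρ hC le_rfl hG₀0 hsrc ht
  have hρ0 : ∫ x, ‖ρ a x‖ ^ 2 = 0 := by
    have h : ∀ x, ρ a x = 0 := fun x => by simp only [hρ_def, hr_def, hδ_def, h0, hζ0, sub_self]
    simp only [h, norm_zero, ne_eq, OfNat.ofNat_ne_zero, not_false_eq_true, zero_pow, integral_zero]
  rw [hρ0, zero_add, add_zero] at hgr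
  have hL0 : 0 ≤ ∑ i, C i := Finset.sum_nonneg fun i _ => (norm_nonneg _).trans (hC i a ha 0)
  have ht1 : 0 ≤ t - a := by linarith [ht.1]
  have ht2 : t - a ≤ τ := by rw [hb] at ht; linarith [ht.2]
  have hexp : Real.exp ((2 * ∑ i, C i) * (t - a)) ≤ Real.exp (2 * Λ * τ) := by
    refine Real.exp_le_exp.2 ?_
    calc (2 * ∑ i, C i) * (t - a) ≤ 2 * Λ * (t - a) := by gcongr
      _ ≤ 2 * Λ * τ := by gcongr
  have hG₀c : G₀ = c * H₀ ^ 3 := by simp only [hG₀, hc]; ring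
  calc ∫ x, ‖u₂ t x - u₁ t x - w t x - ζ t x‖ ^ 2 = ∫ x, ‖ρ t x‖ ^ 2 := rfl
    _ ≤ G₀ * (t - a) * Real.exp ((2 * ∑ i, C i) * (t - a)) := hgr
    _ ≤ G₀ * τ * Real.exp (2 * Λ * τ) := by gcongr
    _ = c * τ * Real.exp (2 * Λ * τ) * H₀ ^ 3 := by rw [hG₀c]; ring

end Three

end Torus

end Literature.Analysis.FunctionSpaces
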